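import Summits.ABC.IUTFork.LanaKummerInjective
import Summits.ABC.IUTFork.LanaKummerInjectiveAdic
import HarnessLib

/-!
# L-LANA objects XII ter: the Kummer embedding at the level of `Π_v` (LANA §4.2 (b) bullet 2, literally)

Record-only file (D-0012) of the abc-iut cell (seat abc-iut-c312-4, L-LANA level, plan/LLANA-SPEC N9/N13);
TAKES NO SIDE on [IUTchIII] Cor. 3.12. LANA §4.2 (b) p. 26: "one can reconstruct the following objects from (a
topological group abstractly isomorphic to) the tempered fundamental group `Π_v`: … • The embedding
`K_v^× = (K̄_v^×)^{G_v} ↪ H¹(Π_v, Λ(O^×_v))` by Kummer theory." The sibling files built and proved this AT THE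
LEVEL OF `G_v` (`LanaKummer.lean`: `AlgCl.kummerBase`; `LanaKummerInjective.lean`: injective under
`DivisibleElementsTrivial K_vˣ`, unconditionally at `ℚ_p`; `LanaKummerInjectiveAdic.lean`: unconditionally at
every finite place), recording the passage to `Π_v` as "inflation along `Π_v ↠ G_v`, not typed" (referee
abc-iut-ref-b PASS-B7 finding B7-1: print says `Π_v`). THIS file types the printed `Π_v`-level statement for
ANY group `Π` with a surjection `ρ : Π ↠ G_v` (LANA §3.8 (a) p. 20: "`Π_v ↠ G_v`"; at a bad place `Π_v` is the
tempered fundamental group, at a good place the étale one — here `Π` is arbitrary), `Π` acting on `K̄_v^×`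
THROUGH `ρ`:

* `AlgCl.UnitsVia ρ` — `K̄_v^×` as a `Π`-group through `ρ` (a type synonym of `(AlgCl K_v)ˣ` carrying the
  pulled-back action; still rootable);
* `AlgCl.mem_invariants_unitsVia_iff` — for SURJECTIVE `ρ` the `Π`-invariants are the `G_v`-invariants, so
  (`unitsEquivInvariantsVia`) **`K_v^× ≃ (K̄_v^×)^{Π}`** (characteristic `0`); without surjectivity only
  `(K̄_v^×)^{G_v} ⊆ (K̄_v^×)^{Π}` (`invariants_gal_le_invariants_unitsVia`);
* `AlgCl.kummerBasePi ρ : (K̄_v^×)^{Π} → H¹(Π, Λ(K̄_v^×))` := L2-t3's `kummerMapFixed` for the `Π`-action, and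
  `AlgCl.kummerEmbeddingPi ρ` = the printed composite `K_v^× = (K̄_v^×)^{Π} → H¹(Π, Λ(K̄_v^×))`;
* `AlgCl.kummerCocycle_unitsVia` — the `Π`-level Kummer cocycle IS the `G_v`-level one composed with `ρ`
  (i.e. the class is the INFLATION of the `G_v`-class along `ρ`, stated on cocycles);
* **injectivity**: `kummerBasePi_injective_of` / `kummerEmbeddingPi_injective_of` under
  `DivisibleElementsTrivial K_vˣ` (same kernel criterion, L2-t3 `kummerMapFixed_injective_of_iInter_pow_eq_bot`:
  a class dies iff its element has a compatible system of `Π`-invariant — i.e. `K_v`-rational — roots);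
  UNCONDITIONAL at `K_v = ℚ_p` (`padic_kummerEmbeddingPi_injective`) and at `K_v = K_𝔭 = v.adicCompletion K`
  for every finite place `v` of every number field `K` (`adicCompletion_kummerEmbeddingPi_injective`).

Modelling notes. (i) Coefficients `Λ(O^×_v) = Λ(K̄_v^×)` as in `LanaKummer.lean` note (i). (ii) The
cohomology is Mathlib's (discrete) `groupCohomology.H1` of the `Π`-module `Λ(K̄_v^×)`, as in the siblings; for
a topological `Π` the continuous `H¹` injects into it (layer L2, `EtaleTheta/ContH1Discrete.lean`), so
injectivity INTO the discrete group is the stronger statement. (iii) The place datum is the CONSTRUCTED one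
of `LanaLocalField.lean` (`K̄_v := AlgCl K_v`, `G_v := Gal(K̄_v/K_v)`); plugging the tree's tempered curves
(`SemiGraphs.TemperedCurve`: base field `K ⊆ ℚ̄_p`, `aug : Π^temp ↠ G_K ≤ G_{ℚ_p}`) needs the same statements
over an ambient algebraically closed `Ω ⊇ K_v` in place of `AlgCl K_v` — not here (RESIDUAL-LANA N5/N9).
[cite: LANA2026Report, §4.2 (b) p. 26, §3.8 (a) p. 20, §6.1 p. 31] NOT here: any judgement.
-/

noncomputable section

namespace Summit.ABC
namespace IUTFork
namespace AlgCl

open Literature.AnabelianGeometry.EtaleTheta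
open Literature.AnabelianGeometry.AbsoluteAnabelian.AbsTopIII (DivisibleElementsTrivial)
open scoped NNReal

section Via

variable (K₀ : Type) [NontriviallyNormedField K₀]
variable {P : Type} [Group P] (ρ : P →* Gal K₀)

/-- **`K̄_v^×` as a `Π`-group through `ρ : Π → G_v`** ("the topological field `K̄_v` with the natural
continuous action of `Π_v`", §4.2 (b) first bullet, on units): a type synonym of `K̄_v^×` on which `Π` acts by
`g • u := ρ(g) • u`. [cite: LANA2026Report, §4.2 (b) p. 26] -/
def UnitsVia (_ρ : P →* Gal K₀) : Type := (AlgCl K₀)ˣ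

/-- `K̄_v^×` (through `ρ`) is a commutative group. [cite: LANA2026Report, §4.2 (b) p. 26] -/
instance UnitsVia.instCommGroup : CommGroup (UnitsVia K₀ ρ) := inferInstanceAs (CommGroup (AlgCl K₀)ˣ)

/-- **`Π ↷ K̄_v^×` through `ρ`** (the pulled-back action `MulDistribMulAction.compHom`).
[cite: LANA2026Report, §4.2 (b) p. 26] -/
instance UnitsVia.instAction : MulDistribMulAction P (UnitsVia K₀ ρ) :=
  MulDistribMulAction.compHom (AlgCl K₀)ˣ ρ

/-- `K̄_v^×` (through `ρ`) is rootable (hypothesis (a) of §6.1, `LanaKummer.rootableUnits`).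
[cite: LANA2026Report, §6.1 (a) p. 31] -/
instance UnitsVia.instRootableBy : RootableBy (UnitsVia K₀ ρ) ℕ :=
  inferInstanceAs (RootableBy (AlgCl K₀)ˣ ℕ)

/-- The identification `K̄_v^× = K̄_v^×` (forgetting through which group one acts), as a group isomorphism.
[cite: LANA2026Report, §4.2 (b) p. 26] -/
def UnitsVia.of : (AlgCl K₀)ˣ ≃* UnitsVia K₀ ρ := MulEquiv.refl _

/-- The action through `ρ`, computed: `g • u = ρ(g) • u`. [cite: LANA2026Report, §4.2 (b) p. 26] -/
theorem UnitsVia.smul_def (g : P) (u : UnitsVia K₀ ρ) :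
    g • u = UnitsVia.of K₀ ρ (ρ g • (UnitsVia.of K₀ ρ).symm u) := rfl

/-- `(K̄_v^×)^{G_v} ⊆ (K̄_v^×)^{Π}`: an element fixed by `G_v` is fixed by `Π` acting through `ρ` (no
surjectivity needed). [cite: LANA2026Report, §4.2 (b) p. 26] -/
theorem mem_invariants_unitsVia_of_gal (u : (AlgCl K₀)ˣ)
    (hu : u ∈ invariants (A := (AlgCl K₀)ˣ) (⊤ : Subgroup (Gal K₀))) :
    UnitsVia.of K₀ ρ u ∈ invariants (A := UnitsVia K₀ ρ) (⊤ : Subgroup P) := by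
  rw [invariants, FixedPoints.mem_subgroup] at hu ⊢
  intro g
  change ((g : P) • UnitsVia.of K₀ ρ u) = UnitsVia.of K₀ ρ u
  rw [UnitsVia.smul_def]
  exact congrArg (UnitsVia.of K₀ ρ) (hu ⟨ρ g, trivial⟩)

/-- **For surjective `ρ : Π ↠ G_v` the `Π`-invariants ARE the `G_v`-invariants**: `(K̄_v^×)^{Π} = (K̄_v^×)^{G_v}`.
[cite: LANA2026Report, §4.2 (b) p. 26, §3.8 (a) p. 20] -/
theorem mem_invariants_unitsVia_iff (hρ : Function.Surjective ρ) (u : UnitsVia K₀ ρ) :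
    u ∈ invariants (A := UnitsVia K₀ ρ) (⊤ : Subgroup P) ↔
      (UnitsVia.of K₀ ρ).symm u ∈ invariants (A := (AlgCl K₀)ˣ) (⊤ : Subgroup (Gal K₀)) := by
  refine ⟨fun hu => ?_, fun hu => mem_invariants_unitsVia_of_gal K₀ ρ _ hu⟩
  rw [invariants, FixedPoints.mem_subgroup] at hu ⊢
  intro σ
  obtain ⟨g, hg⟩ := hρ σ
  have h := hu ⟨g, trivial⟩
  change g • u = u at h
  rw [UnitsVia.smul_def, hg] at h
  change ((σ : Gal K₀) • (UnitsVia.of K₀ ρ).symm u) = (UnitsVia.of K₀ ρ).symm u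
  exact (UnitsVia.of K₀ ρ).injective (by simpa using h)

/-- The `G_v`-invariants embed into the `Π`-invariants, as a homomorphism (equality of the two for
surjective `ρ`). [cite: LANA2026Report, §4.2 (b) p. 26] -/
def invariantsGalToVia :
    invariants (A := (AlgCl K₀)ˣ) (⊤ : Subgroup (Gal K₀)) →* invariants (A := UnitsVia K₀ ρ) (⊤ : Subgroup P) where
  toFun a := ⟨UnitsVia.of K₀ ρ a, mem_invariants_unitsVia_of_gal K₀ ρ a a.2⟩
  map_one' := Subtype.ext (by
    change UnitsVia.of K₀ ρ ((1 : invariants (A := (AlgCl K₀)ˣ) (⊤ : Subgroup (Gal K₀))) : (AlgCl K₀)ˣ) = 1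
    rw [Subgroup.coe_one, map_one])
  map_mul' a b := Subtype.ext (by
    change UnitsVia.of K₀ ρ ((a * b : invariants (A := (AlgCl K₀)ˣ) (⊤ : Subgroup (Gal K₀))) : (AlgCl K₀)ˣ) =
      UnitsVia.of K₀ ρ a * UnitsVia.of K₀ ρ b
    rw [Subgroup.coe_mul, map_mul])

/-- Underlying element of `invariantsGalToVia a`. [cite: LANA2026Report, §4.2 (b) p. 26] -/
@[simp] theorem coe_invariantsGalToVia (a : invariants (A := (AlgCl K₀)ˣ) (⊤ : Subgroup (Gal K₀))) :
    ((invariantsGalToVia K₀ ρ a : invariants (A := UnitsVia K₀ ρ) ⊤) : UnitsVia K₀ ρ) = UnitsVia.of K₀ ρ a := rfl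

/-- `invariantsGalToVia` is injective. [cite: LANA2026Report, §4.2 (b) p. 26] -/
theorem invariantsGalToVia_injective : Function.Injective (invariantsGalToVia K₀ ρ) := fun _ _ h =>
  Subtype.ext ((UnitsVia.of K₀ ρ).injective
    (congrArg (fun x : invariants (A := UnitsVia K₀ ρ) (⊤ : Subgroup P) => (x : UnitsVia K₀ ρ)) h))

/-- … and surjective when `ρ` is. [cite: LANA2026Report, §4.2 (b) p. 26, §3.8 (a) p. 20] -/
theorem invariantsGalToVia_surjective (hρ : Function.Surjective ρ) :
    Function.Surjective (invariantsGalToVia K₀ ρ) := fun u =>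
  ⟨⟨(UnitsVia.of K₀ ρ).symm u, (mem_invariants_unitsVia_iff K₀ ρ hρ u).mp u.2⟩, Subtype.ext (by simp)⟩

/-- **The Kummer cocycle through `ρ` is the `G_v`-cocycle composed with `ρ`** (so the `Π`-level class is the
inflation of the `G_v`-level class along `ρ`): for a compatible root system `x` of a `G_v`-invariant `a`,
`(g ↦ (g·x_n/x_n)_n) = (σ ↦ (σ·x_n/x_n)_n) ∘ ρ`. [cite: LANA2026Report, §4.2 (b) p. 26, §6.1 p. 31] -/
theorem kummerCocycle_unitsVia {a : (AlgCl K₀)ˣ} (x : RootSystem a)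
    (ha : a ∈ MulAction.fixedPoints (⊤ : Subgroup (Gal K₀)) (AlgCl K₀)ˣ) (g : (⊤ : Subgroup P)) (n : ℕ+) :
    ((RootSystem.kummerCocycle (H := (⊤ : Subgroup P)) (x.map (UnitsVia.of K₀ ρ).toMonoidHom)
        (mem_invariants_unitsVia_of_gal K₀ ρ a ha) g : cyclotome (UnitsVia K₀ ρ)) : ℕ+ → UnitsVia K₀ ρ) n =
      UnitsVia.of K₀ ρ (((x.kummerCocycle ha ⟨ρ g, trivial⟩ : cyclotome (AlgCl K₀)ˣ) : ℕ+ → (AlgCl K₀)ˣ) n) :=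
  rfl

/-- **The Kummer map at the level of `Π`**: `(K̄_v^×)^{Π} → H¹(Π, Λ(K̄_v^×))`, `Π` acting through `ρ` — L2-t3's
`kummerMapFixed` for the pulled-back action (§6.1 "`M^H → (M^{gp})^H → H¹(H, Λ(M))`" with `H = Π`).
[cite: LANA2026Report, §4.2 (b) p. 26, §6.1 p. 31] -/
def kummerBasePi :
    Additive (invariants (A := UnitsVia K₀ ρ) (⊤ : Subgroup P)) →+
      groupCohomology.H1 (cyclotomeRep (A := UnitsVia K₀ ρ) (⊤ : Subgroup P)) :=
  kummerMapFixed ⊤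

/-- `κ_Π(ab) = κ_Π(a) + κ_Π(b)`. [cite: LANA2026Report, §6.1 p. 31] -/
theorem kummerBasePi_mul (a b : invariants (A := UnitsVia K₀ ρ) (⊤ : Subgroup P)) :
    kummerBasePi K₀ ρ (Additive.ofMul (a * b)) =
      kummerBasePi K₀ ρ (Additive.ofMul a) + kummerBasePi K₀ ρ (Additive.ofMul b) :=
  map_add (kummerBasePi K₀ ρ) (Additive.ofMul a) (Additive.ofMul b)

/-! ### The `Π`-level class is the inflation (`groupCohomology.map` along `ρ`) of the `G_v`-level class -/

/-- `ρ` as a homomorphism between the (full) subgroups `⊤ ≤ Π` and `⊤ ≤ G_v` over which the two Kummer maps are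
taken. [cite: LANA2026Report, §3.8 (a) p. 20] -/
def topHom : (⊤ : Subgroup P) →* (⊤ : Subgroup (Gal K₀)) :=
  (ρ.comp (Subgroup.subtype ⊤)).codRestrict ⊤ fun _ => trivial

/-- `topHom ρ g = ρ g`. [cite: LANA2026Report, §3.8 (a) p. 20] -/
@[simp] theorem coe_topHom (g : (⊤ : Subgroup P)) : ((topHom K₀ ρ g : (⊤ : Subgroup (Gal K₀))) : Gal K₀) = ρ g :=
  rfl

/-- The coefficient map `Λ(K̄_v^×) → Λ(K̄_v^×)` (identity on underlying systems of roots of unity) from the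
`G_v`-module restricted along `ρ` to the `Π`-module through `ρ`, as a morphism of `Π`-representations — the
coefficient part of the inflation map `H¹(G_v, Λ) → H¹(Π, Λ)`. [cite: LANA2026Report, §4.2 (b) p. 26, §6.1 p. 32] -/
def inflCoeff :
    Rep.res (topHom K₀ ρ) (cyclotomeRep (A := (AlgCl K₀)ˣ) (⊤ : Subgroup (Gal K₀))) ⟶
      cyclotomeRep (A := UnitsVia K₀ ρ) (⊤ : Subgroup P) :=
  Rep.ofHom (LinearMap.intertwiningMap_of_isIntertwiningMap _ _
    (MonoidHom.toAdditive (cyclotome.map (UnitsVia.of K₀ ρ).toMonoidHom)).toIntLinearMap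
    fun _ _ => rfl)

/-- **Inflation.** The `Π`-level Kummer class of a `G_v`-invariant unit is the image of its `G_v`-level Kummer
class (`LanaKummer.kummerAt ⊤`) under Mathlib's functoriality map `groupCohomology.map` along `ρ : Π → G_v` with
the identity on coefficients — i.e. "`H¹(G_v, Λ) → H¹(Π_v, Λ)` is inflation along `Π_v ↠ G_v`" made precise
(no surjectivity needed for this identity). [cite: LANA2026Report, §4.2 (b) p. 26, §6.1 p. 32] -/
theorem kummerBasePi_eq_map (a : invariants (A := (AlgCl K₀)ˣ) (⊤ : Subgroup (Gal K₀))) :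
    kummerBasePi K₀ ρ (Additive.ofMul (invariantsGalToVia K₀ ρ a)) =
      groupCohomology.map (topHom K₀ ρ) (inflCoeff K₀ ρ) 1 (kummerAt K₀ ⊤ (Additive.ofMul a)) := by
  have hL : kummerBasePi K₀ ρ (Additive.ofMul (invariantsGalToVia K₀ ρ a)) =
      kummerClassOfRootSystem (⊤ : Subgroup P)
        ((RootSystem.ofRootableBy (a : (AlgCl K₀)ˣ)).map (UnitsVia.of K₀ ρ).toMonoidHom)
        (mem_invariants_unitsVia_of_gal K₀ ρ a a.2) := by
    rw [kummerBasePi, kummerMapFixed_apply]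
    exact kummerClass_eq_of_rootSystem ⊤ _ _
  rw [hL, kummerAt, kummerMapFixed_apply, kummerClass, kummerClassOfRootSystem, kummerClassOfRootSystem,
    groupCohomology.H1π_comp_map_apply]
  congr 1

end Via

section CharZero

variable (K₀ : Type) [NontriviallyNormedField K₀] [CharZero K₀]
variable {P : Type} [Group P] (ρ : P →* Gal K₀)

/-- **`K_v^× ≃ (K̄_v^×)^{Π}`** for surjective `ρ : Π ↠ G_v` (characteristic `0`): the composite of gen-2's
`K_v^× ≃ (K̄_v^×)^{G_v}` (`unitsEquivInvariants`) with `(K̄_v^×)^{G_v} = (K̄_v^×)^{Π}`.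
[cite: LANA2026Report, §4.2 (b) p. 26, §3.8 (a) p. 20] -/
def unitsEquivInvariantsVia (hρ : Function.Surjective ρ) :
    K₀ˣ ≃* invariants (A := UnitsVia K₀ ρ) (⊤ : Subgroup P) :=
  (unitsEquivInvariants K₀).trans
    (MulEquiv.ofBijective (invariantsGalToVia K₀ ρ)
      ⟨invariantsGalToVia_injective K₀ ρ, invariantsGalToVia_surjective K₀ ρ hρ⟩)

/-- On underlying elements `unitsEquivInvariantsVia x = x ∈ K̄_v`. [cite: LANA2026Report, §4.2 (b) p. 26] -/
@[simp] theorem coe_unitsEquivInvariantsVia (hρ : Function.Surjective ρ) (x : K₀ˣ) :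
    (((UnitsVia.of K₀ ρ).symm
        ((unitsEquivInvariantsVia K₀ ρ hρ x : invariants (A := UnitsVia K₀ ρ) ⊤) : UnitsVia K₀ ρ) :
        (AlgCl K₀)ˣ) : AlgCl K₀) = algebraMap K₀ (AlgCl K₀) x := by
  simp [unitsEquivInvariantsVia, UnitsVia.of]

/-- **LANA §4.2 (b), second bullet, AT THE LEVEL OF `Π_v`: "the embedding
`K_v^× = (K̄_v^×)^{G_v} ↪ H¹(Π_v, Λ(O^×_v))` by Kummer theory"** — for any surjection `ρ : Π ↠ G_v`, the
composite `K_v^× ≃ (K̄_v^×)^{Π} → H¹(Π, Λ(K̄_v^×))` (injectivity: `kummerEmbeddingPi_injective_of`).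
[cite: LANA2026Report, §4.2 (b) p. 26] -/
def kummerEmbeddingPi (hρ : Function.Surjective ρ) :
    Additive K₀ˣ →+ groupCohomology.H1 (cyclotomeRep (A := UnitsVia K₀ ρ) (⊤ : Subgroup P)) :=
  (kummerBasePi K₀ ρ).comp (MonoidHom.toAdditive (unitsEquivInvariantsVia K₀ ρ hρ).toMonoidHom)

/-- `kummerEmbeddingPi x = kummerBasePi (x ∈ (K̄_v^×)^{Π})`. [cite: LANA2026Report, §4.2 (b) p. 26] -/
theorem kummerEmbeddingPi_apply (hρ : Function.Surjective ρ) (x : K₀ˣ) :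
    kummerEmbeddingPi K₀ ρ hρ (Additive.ofMul x) =
      kummerBasePi K₀ ρ (Additive.ofMul (unitsEquivInvariantsVia K₀ ρ hρ x)) := rfl

/-- **INJECTIVITY of `(K̄_v^×)^{Π} → H¹(Π, Λ(K̄_v^×))`** for surjective `ρ`, under `⋂_n (K_v^×)^n = 1`
([AbsTopIII] Def. 1.5 (a), `DivisibleElementsTrivial K_vˣ`): a class vanishes iff its element admits a
compatible system of `Π`-invariant roots (L2-t3 `KummerKernel`); `Π`-invariant = `K_v`-rational (`ρ`
surjective), and such a system forces the element to be `1`. [cite: LANA2026Report, §4.2 (b) p. 26, §6.1 p. 31] -/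
theorem kummerBasePi_injective_of (hρ : Function.Surjective ρ) (h : DivisibleElementsTrivial K₀ˣ) :
    Function.Injective (kummerBasePi K₀ ρ) := by
  unfold kummerBasePi
  refine kummerMapFixed_injective_of_iInter_pow_eq_bot (A := UnitsVia K₀ ρ) ⊤ fun a ha => ?_
  obtain ⟨x, rfl⟩ := (unitsEquivInvariantsVia K₀ ρ hρ).surjective a
  have hx : x = 1 := h.eq_one_of_forall_exists_pow x fun n hn => by
    obtain ⟨b, hb⟩ := ha ⟨n, hn⟩
    obtain ⟨y, rfl⟩ := (unitsEquivInvariantsVia K₀ ρ hρ).surjective b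
    refine ⟨y, (unitsEquivInvariantsVia K₀ ρ hρ).injective ?_⟩
    rw [map_pow]
    exact hb
  rw [hx, map_one]

/-- **The embedding `K_v^× ↪ H¹(Π, Λ(K̄_v^×))` is injective** (surjective `ρ`, `⋂_n (K_v^×)^n = 1`).
[cite: LANA2026Report, §4.2 (b) p. 26] -/
theorem kummerEmbeddingPi_injective_of (hρ : Function.Surjective ρ) (h : DivisibleElementsTrivial K₀ˣ) :
    Function.Injective (kummerEmbeddingPi K₀ ρ hρ) :=
  (kummerBasePi_injective_of K₀ ρ hρ h).comp fun _ _ hab =>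
    Additive.toMul.injective ((unitsEquivInvariantsVia K₀ ρ hρ).injective (Additive.ofMul.injective hab))

/-- Hence `κ_Π(x) = 0 ⟺ x = 1` on `K_v^×`. [cite: LANA2026Report, §4.2 (b) p. 26] -/
theorem kummerEmbeddingPi_eq_zero_iff_of (hρ : Function.Surjective ρ) (h : DivisibleElementsTrivial K₀ˣ)
    (x : K₀ˣ) : kummerEmbeddingPi K₀ ρ hρ (Additive.ofMul x) = 0 ↔ x = 1 := by
  constructor
  · intro h0
    have h1 : Additive.ofMul x = 0 := kummerEmbeddingPi_injective_of K₀ ρ hρ h (by rw [h0, map_zero])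
    exact Additive.ofMul.injective h1
  · rintro rfl
    exact map_zero (kummerEmbeddingPi K₀ ρ hρ)

/-- The case `Π = G_v`, `ρ = id`: the `Π`-level embedding specialises to (a copy of) gen-2's `G_v`-level one —
same underlying cocycles (`kummerCocycle_unitsVia` with `ρ = id`); recorded as the consistency check that
`id` is surjective and the statement applies. [cite: LANA2026Report, §4.2 (b) p. 26] -/
theorem kummerEmbeddingPi_id_injective_of (h : DivisibleElementsTrivial K₀ˣ) :
    Function.Injective (kummerEmbeddingPi K₀ (MonoidHom.id (Gal K₀)) Function.surjective_id) :=
  kummerEmbeddingPi_injective_of K₀ _ _ h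

end CharZero

/-! ### `K_v = ℚ_p` and `K_v = K_𝔭`: no hypothesis left -/

section Padic

variable (p : ℕ) [Fact p.Prime] {P : Type} [Group P] (ρ : P →* Gal ℚ_[p])

/-- **LANA §4.2 (b) at `K_v = ℚ_p`, UNCONDITIONALLY, for every surjection `ρ : Π ↠ G_{ℚ_p}`**: the Kummer map
`(ℚ̄_p^×)^{Π} → H¹(Π, Λ(ℚ̄_p^×))` is injective. [cite: LANA2026Report, §4.2 (b) p. 26] -/
theorem padic_kummerBasePi_injective (hρ : Function.Surjective ρ) :
    Function.Injective (kummerBasePi ℚ_[p] ρ) :=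
  kummerBasePi_injective_of ℚ_[p] ρ hρ (padic_divisibleElementsTrivial p)

/-- … and so is the embedding `ℚ_p^× ↪ H¹(Π, Λ(ℚ̄_p^×))`. [cite: LANA2026Report, §4.2 (b) p. 26] -/
theorem padic_kummerEmbeddingPi_injective (hρ : Function.Surjective ρ) :
    Function.Injective (kummerEmbeddingPi ℚ_[p] ρ hρ) :=
  kummerEmbeddingPi_injective_of ℚ_[p] ρ hρ (padic_divisibleElementsTrivial p)

end Padic

section Adic

open IsDedekindDomain NumberField

-- `K_𝔭` as a nontrivially normed field of characteristic `0` (the tree's reducible definition / theorem, as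
-- LOCAL instances, exactly as in `LanaKummerInjectiveAdic.lean`) so that `AlgCl K_𝔭` elaborates.
attribute [local instance] Literature.NumberTheory.GaloisRepresentations.Ultrametric.AdicCompletion.nontriviallyNormedField
attribute [local instance] Literature.NumberTheory.GaloisRepresentations.charZero_adicCompletion

variable (K : Type) [Field K] [NumberField K] (v : HeightOneSpectrum (𝓞 K))
variable {P : Type} [Group P] (ρ : P →* Gal (v.adicCompletion K))

/-- **LANA §4.2 (b) at `K_v = K_𝔭` (every finite place of every number field), UNCONDITIONALLY, for every
surjection `ρ : Π ↠ G_{K_𝔭}`**: `(K̄_𝔭^×)^{Π} → H¹(Π, Λ(K̄_𝔭^×))` is injective (`⋂_n (K_𝔭^×)^n = 1` is gen-2's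
`adicCompletion_divisibleElementsTrivial`). [cite: LANA2026Report, §4.2 (b) p. 26] -/
theorem adicCompletion_kummerBasePi_injective (hρ : Function.Surjective ρ) :
    Function.Injective (kummerBasePi (v.adicCompletion K) ρ) :=
  kummerBasePi_injective_of _ ρ hρ (adicCompletion_divisibleElementsTrivial K v)

/-- … and so is the embedding `K_𝔭^× ↪ H¹(Π, Λ(K̄_𝔭^×))`. [cite: LANA2026Report, §4.2 (b) p. 26] -/
theorem adicCompletion_kummerEmbeddingPi_injective (hρ : Function.Surjective ρ) :
    Function.Injective (kummerEmbeddingPi (v.adicCompletion K) ρ hρ) :=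
  kummerEmbeddingPi_injective_of _ ρ hρ (adicCompletion_divisibleElementsTrivial K v)

end Adic

end AlgCl

end IUTFork

end Summit.ABC

end
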